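import Literature.Probability.LatticeModels.AssociationSupermodularOrder
import Literature.Combinatorics.Sahi2008.FKG
import Literature.Combinatorics.Sahi2008.SequentialCoupling
import Literature.Probability.LatticeModels.NegativeAssociation
import HarnessLib

/-!
# FKG weights dominate their product of marginals in the supermodular order (companion of `AssociationSupermodularOrder.lean`)

Topic `Literature/Probability/LatticeModels`.  The FKG inequality [FortuinKasteleynGinibre1971] says that an FKG probability
weight (`Literature.Combinatorics.Sahi2008.IsFKGMeasure`: nonnegative, mass `1`, lattice condition `w(x)w(y) ≤ w(x ⊓ y)w(x ⊔ y)`)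
is positively associated; with Shaked–Shanthikumar Thm. 9.A.23(a) = Christofides–Vaggelatou 2004 (tree:
`AssociationOrder.sum_indepOf_mul_le_of_isPosAssoc`, binary coordinates) it follows that an FKG weight on the cube
`Fin n → Bool` dominates the independent law with the same marginals in the supermodular order.  This file records exactly
that chain, plus the identification of `AssociationOrder.tailW` with the tree's `Sahi2008.tailMarginal` (Kahn's sequential
coupling marginal).  No definitions beyond plumbing, no named facts, standard axioms.

* `isPosAssoc_of_isFKGMeasure` — FKG lattice condition ⇒ `IsPosAssoc` (functions form, all monotone `f, g` of any sign:
  shift to nonnegative functions and use the tree's `ex_mul_ex_le_ex_mul` = Mathlib `fkg`). [FortuinKasteleynGinibre1971]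
* `sum_indepOf_mul_le_of_isFKGMeasure` — `Σₓ indepOf w x · φ x ≤ Σₓ w x · φ x` for every supermodular `φ`.
  [ShakedShanthikumar2007, Thm. 9.A.23(a)] + [FortuinKasteleynGinibre1971]
* `tailW_eq_tailMarginal`. [Kahn2022, footnote 1(a)]
* `isFKGMeasure_indepOf`, `isPosAssoc_indepOf` — the independent law with the same marginals is an FKG probability weight
  (lattice condition with equality, coordinatewise), hence positively associated. [BarlowProschan1975, Thm. 2.2]
* `isNegAssoc_iff_isNA` — `IsNegAssoc` is the tree's `NegativeAssociation.IsNA` (Joag-Dev–Proschan Def. 2.1) on the cube.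

## References
* C. M. Fortuin, P. W. Kasteleyn, J. Ginibre, Comm. Math. Phys. 22 (1971) 89–103. [FortuinKasteleynGinibre1971]
* M. Shaked, J. G. Shanthikumar, *Stochastic Orders*, Springer 2007, Thm. 9.A.23. [ShakedShanthikumar2007]
* J. Kahn, *A note on positive association*, arXiv:2210.08653, footnote 1. [Kahn2022]
-/

noncomputable section
open Finset

namespace Literature.Probability.LatticeModels
namespace AssociationOrder

variable {n : ℕ}

/-- `tailW` is the tree's `Sahi2008.tailMarginal` (Kahn's sequential-coupling marginal), written as a sum over `Bool`.
[cite: Kahn2022, p. 2 footnote 1 (a)] -/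
theorem tailW_eq_tailMarginal (w : (Fin (n + 1) → Bool) → ℝ) :
    tailW w = Literature.Combinatorics.Sahi2008.tailMarginal w := by
  funext y
  simp only [tailW, Literature.Combinatorics.Sahi2008.tailMarginal, Fintype.sum_bool, add_comm]

/-- Shifting a test function by a constant (mass `1`). [folklore] -/
private theorem sum_mul_sub_const {w : (Fin n → Bool) → ℝ} (hw1 : ∑ x, w x = 1) (f : (Fin n → Bool) → ℝ) (a : ℝ) :
    ∑ x, w x * (f x - a) = (∑ x, w x * f x) - a := by
  simp only [mul_sub, Finset.sum_sub_distrib, ← Finset.sum_mul, hw1, one_mul]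

/-- **FKG ⇒ positive association** on the cube: an FKG probability weight is positively associated — the FKG inequality
(tree `ex_mul_ex_le_ex_mul`, from Mathlib's `fkg`) after shifting `f, g` by `f ⊥, g ⊥` to be nonnegative; the association
defect is shift-invariant for mass `1`. [cite: FortuinKasteleynGinibre1971, Thm. (Prop. 1)] [cite: BarlowProschan1975, Ch. 2 Definition 2.1] -/
theorem isPosAssoc_of_isFKGMeasure {w : (Fin n → Bool) → ℝ} (hw : Literature.Combinatorics.Sahi2008.IsFKGMeasure w) :
    IsPosAssoc w := by
  intro f g hf hg
  have hfb : ∀ x, 0 ≤ f x - f ⊥ := fun x => sub_nonneg.2 (hf bot_le)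
  have hgb : ∀ x, 0 ≤ g x - g ⊥ := fun x => sub_nonneg.2 (hg bot_le)
  have hfm : Monotone fun x => f x - f ⊥ := fun x y h => sub_le_sub_right (hf h) _
  have hgm : Monotone fun x => g x - g ⊥ := fun x y h => sub_le_sub_right (hg h) _
  have key := Literature.Combinatorics.Sahi2008.ex_mul_ex_le_ex_mul hw hfb hgb hfm hgm
  simp only [Literature.Combinatorics.Sahi2008.ex, Pi.mul_apply] at key
  rw [sum_mul_sub_const hw.sum_eq_one f, sum_mul_sub_const hw.sum_eq_one g] at key
  have e3 : ∑ x, w x * ((f x - f ⊥) * (g x - g ⊥)) =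
      (∑ x, w x * (f x * g x)) - g ⊥ * (∑ x, w x * f x) - f ⊥ * (∑ x, w x * g x) + f ⊥ * g ⊥ := by
    have : ∀ x, w x * ((f x - f ⊥) * (g x - g ⊥)) =
        w x * (f x * g x) - g ⊥ * (w x * f x) - f ⊥ * (w x * g x) + f ⊥ * g ⊥ * w x := fun x => by ring
    simp only [this, Finset.sum_add_distrib, Finset.sum_sub_distrib, ← Finset.mul_sum, hw.sum_eq_one, mul_one]
  rw [e3] at key
  rw [hw.sum_eq_one, one_mul]
  nlinarith [key]

/-- **FKG weights dominate their product of marginals in the supermodular order** (binary coordinates): for an FKG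
probability weight `w` on `Fin n → Bool` and every supermodular `φ`, `Σₓ indepOf w x · φ x ≤ Σₓ w x · φ x`.
[cite: ShakedShanthikumar2007, Thm. 9.A.23(a)] [cite: FortuinKasteleynGinibre1971, Thm. (Prop. 1)] -/
theorem sum_indepOf_mul_le_of_isFKGMeasure {w : (Fin n → Bool) → ℝ} (hw : Literature.Combinatorics.Sahi2008.IsFKGMeasure w)
    (φ : (Fin n → Bool) → ℝ) (hφ : IsSupermodular φ) : ∑ x, indepOf w x * φ x ≤ ∑ x, w x * φ x :=
  sum_indepOf_mul_le_of_isPosAssoc w hw.nonneg hw.sum_eq_one (isPosAssoc_of_isFKGMeasure hw) φ hφ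


/-! ### Independent coordinates are associated (Barlow–Proschan 1975, Thm. 2.2): the product law `indepOf w` is FKG -/

/-- the marginals of a nonnegative weight are nonnegative (plumbing). [folklore] -/
private theorem marg_nonneg' {w : (Fin n → Bool) → ℝ} (hw : ∀ x, 0 ≤ w x) (i : Fin n) (b : Bool) :
    0 ≤ marg w i b := by
  unfold marg
  exact Finset.sum_nonneg fun y _ => by split_ifs <;> [exact hw y; exact le_rfl]

/-- the two marginal masses of a coordinate add up to the total mass (plumbing). [folklore] -/
private theorem sum_marg_bool (w : (Fin n → Bool) → ℝ) (i : Fin n) : ∑ b, marg w i b = ∑ x, w x := by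
  unfold marg
  rw [Finset.sum_comm]
  refine Finset.sum_congr rfl fun x _ => ?_
  rw [Finset.sum_ite_eq]
  simp

/-- one Boolean coordinate: `m(a) m(b) = m(a ⊓ b) m(a ⊔ b)` (a chain; plumbing). [folklore] -/
private theorem mul_bool_inf_sup (m : Bool → ℝ) (a b : Bool) : m a * m b = m (a ⊓ b) * m (a ⊔ b) := by
  cases a <;> cases b <;> simp [mul_comm]

/-- **Independent random variables are associated** (Barlow–Proschan Thm. 2.2), in the strong form used here: for a
probability weight `w` on the cube, the independent law with the same marginals `indepOf w` is an FKG probability weight —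
nonnegative, mass `1`, and the lattice condition holds with EQUALITY coordinate by coordinate (each coordinate is a chain).
Hence `isPosAssoc_of_isFKGMeasure` applies to it. [cite: BarlowProschan1975, Ch. 2 §2, Thm. 2.2 (p. 31)] -/
theorem isFKGMeasure_indepOf {w : (Fin n → Bool) → ℝ} (hw0 : ∀ x, 0 ≤ w x) (hw1 : ∑ x, w x = 1) :
    Literature.Combinatorics.Sahi2008.IsFKGMeasure (indepOf w) where
  nonneg x := Finset.prod_nonneg fun i _ => marg_nonneg' hw0 i (x i)
  sum_eq_one := by
    unfold indepOf
    have h := Finset.sum_prod_piFinset (Finset.univ : Finset Bool) fun (i : Fin n) (b : Bool) => marg w i b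
    rw [Fintype.piFinset_univ] at h
    rw [h]
    exact Finset.prod_eq_one fun i _ => by rw [sum_marg_bool, hw1]
  mul_le_mul x y := by
    unfold indepOf
    rw [← Finset.prod_mul_distrib, ← Finset.prod_mul_distrib]
    refine le_of_eq (Finset.prod_congr rfl fun i _ => ?_)
    exact mul_bool_inf_sup (marg w i) (x i) (y i)

/-- **Independent ⇒ associated** for the product law on the cube. [cite: BarlowProschan1975, Ch. 2 §2, Thm. 2.2 (p. 31)] -/
theorem isPosAssoc_indepOf {w : (Fin n → Bool) → ℝ} (hw0 : ∀ x, 0 ≤ w x) (hw1 : ∑ x, w x = 1) :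
    IsPosAssoc (indepOf w) :=
  isPosAssoc_of_isFKGMeasure (isFKGMeasure_indepOf hw0 hw1)


/-! ### The negative-association predicate is Joag-Dev–Proschan's (tree `NegativeAssociation.IsNA`) -/

/-- `AssociationOrder.IsNegAssoc` (blocks `S`, `Sᶜ`) is the tree's Joag-Dev–Proschan predicate
`NegativeAssociation.IsNA` (arbitrary disjoint blocks `A`, `B`) on the cube: a function of the coordinates in
`B ⊆ Aᶜ` is a function of the coordinates in `Aᶜ`. [cite: JoagDevProschan1983, Def. 2.1] -/
theorem isNegAssoc_iff_isNA (w : (Fin n → Bool) → ℝ) :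
    IsNegAssoc w ↔ Literature.Probability.LatticeModels.NegativeAssociation.IsNA w := by
  constructor
  · intro h A B hAB f g hf hg hfA hgB
    exact h A f g hf hg hfA (hgB.mono hAB.subset_compl_left)
  · intro h S f g hf hg hfS hgS
    exact h disjoint_compl_right hf hg hfS hgS

end AssociationOrder
end Literature.Probability.LatticeModels
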